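import Mathlib
import Summits.ValiantsHypothesis.ValiantsHypothesis.Theorems.LacunarySymmetroidMatrixDescartesOsculationLawRecursionSplit
import Summits.ValiantsHypothesis.ValiantsHypothesis.Theorems.LacunarySymmetroidMatrixDescartesCensusDoorA34DefiniteTriple

/-!
# `MatrixDescartes` (stmt-ValiantsHypothesis-18050), line `osculation_law`, stub `stub_recursion`, residue R6(a) — the
# UNIFORM SHIFT along a density segment: one `C` splits the top letter of every truncation at every point of the segment

Helper file (`--supports stmt-ValiantsHypothesis-18050 --as helper`; cell val-lit, seat val-port-3 g1, merged desk g12;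
glue for the density theorem `gpNodeDensePrime` of the hereditary uniform-shift node family, ROUTE′; val-lit-p7 g13's
uniform-shift design, bus 12:15Z).  Closes NO item.  0 defs.

The ROUTE′ node family asks ONE shift `C > 0` such that at every level the top letter of the truncation splits as
`S_top = YᵀY − C•1` with `det Y ≠ 0`, i.e. `S_top + C•1 ≻ 0`.  Along a segment `S_ε = (1 − ε)•S + ε•W` this is
achieved for ALL `ε ∈ [0,1]` and ALL letters at once by any `C` that works for the finitely many letters of `S` and
of `W` — by CONVEXITY of the positive definite cone, no compactness:

* `posDef_add_smul_one_mono` — `S + c•1 ≻ 0` and `c ≤ C` ⇒ `S + C•1 ≻ 0`;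
* **`exists_uniform_shift`** — finitely many real symmetric matrices ⇒ one `C > 0` with `A_i + C•1 ≻ 0` for all `i`
  (tree: `OsculationRecursion.exists_shift_posDef`, val-lit-p8 g12);
* **`posDef_segment_add_smul_one`** — `A + C•1 ≻ 0`, `B + C•1 ≻ 0`, `ε ∈ [0,1]` ⇒ `(1 − ε)•A + ε•B + C•1 ≻ 0`;
* **`exists_gram_of_posDef_shift`** — `S + C•1 ≻ 0` ⇒ `∃ Y, det Y ≠ 0 ∧ S = YᵀY − C•1`
  (tree: `Census.exists_common_congruence`);
* **`exists_uniform_split_segment`** — for symmetric letter families `S W : Fin K → Matrix ι ι ℝ` there is ONE `C > 0`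
  such that for every `ε ∈ [0,1]` and every letter `l`, `((1 − ε)•S + ε•W) l = YᵀY − C•1` for some `Y` with
  `det Y ≠ 0` — and the same holds for every `C' ≥ C` (so `C` may in addition be taken off any finite bad set).

[folklore] Convexity of the PSD cone.  Honest framing: glue; the density (R6(a)), the osculation LAW, `MatrixDescartes`
(18050) and VP ≠ VNP are NOT proved here.
-/

set_option linter.dupNamespace false

namespace Summit.ValiantsHypothesis.ValiantsHypothesis.Theorems.LacunarySymmetroidMatrixDescartes.GPDensity

open Matrix
open scoped BigOperators

variable {ι : Type*} [Fintype ι] [DecidableEq ι]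

omit [Fintype ι] in
/-- A larger shift stays positive definite. [folklore] -/
theorem posDef_add_smul_one_mono {S : Matrix ι ι ℝ} {c C : ℝ} (h : (S + c • (1 : Matrix ι ι ℝ)).PosDef)
    (hcC : c ≤ C) : (S + C • (1 : Matrix ι ι ℝ)).PosDef := by
  have hsplit : S + C • (1 : Matrix ι ι ℝ) = (S + c • (1 : Matrix ι ι ℝ)) + (C - c) • (1 : Matrix ι ι ℝ) := by
    rw [add_assoc, ← add_smul]; congr 2; ring
  rw [hsplit]
  exact h.add_posSemidef (Matrix.PosSemidef.one.smul (sub_nonneg.mpr hcC))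

/-- **One shift for finitely many symmetric matrices.** [folklore] -/
theorem exists_uniform_shift {κ : Type*} [Fintype κ] (A : κ → Matrix ι ι ℝ) (hA : ∀ k, (A k).IsSymm) :
    ∃ C : ℝ, 0 < C ∧ ∀ k, (A k + C • (1 : Matrix ι ι ℝ)).PosDef := by
  classical
  choose c hc0 hc using fun k => OsculationRecursion.exists_shift_posDef (A k) (hA k)
  have hsum : 0 ≤ ∑ k, c k := Finset.sum_nonneg fun k _ => (hc0 k).le
  refine ⟨1 + ∑ k, c k, by linarith, fun k => posDef_add_smul_one_mono (hc k) ?_⟩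
  have : c k ≤ ∑ k', c k' := Finset.single_le_sum (fun k' _ => (hc0 k').le) (Finset.mem_univ k)
  linarith

omit [Fintype ι] in
/-- **Convexity.**  `A + C•1 ≻ 0`, `B + C•1 ≻ 0`, `0 ≤ ε ≤ 1` ⇒ `(1 − ε)•A + ε•B + C•1 ≻ 0`. [folklore] -/
theorem posDef_segment_add_smul_one {A B : Matrix ι ι ℝ} {C ε : ℝ} (hA : (A + C • (1 : Matrix ι ι ℝ)).PosDef)
    (hB : (B + C • (1 : Matrix ι ι ℝ)).PosDef) (h0 : 0 ≤ ε) (h1 : ε ≤ 1) :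
    ((1 - ε) • A + ε • B + C • (1 : Matrix ι ι ℝ)).PosDef := by
  have hsplit : (1 - ε) • A + ε • B + C • (1 : Matrix ι ι ℝ) =
      (1 - ε) • (A + C • (1 : Matrix ι ι ℝ)) + ε • (B + C • (1 : Matrix ι ι ℝ)) := by
    rw [smul_add, smul_add, smul_smul, smul_smul]
    have : C • (1 : Matrix ι ι ℝ) = ((1 - ε) * C) • (1 : Matrix ι ι ℝ) + (ε * C) • (1 : Matrix ι ι ℝ) := by
      rw [← add_smul]; congr 1; ring
    rw [this]; abel
  rw [hsplit]
  rcases h1.eq_or_lt with rfl | hlt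
  · simpa using hB
  · exact (hA.smul (by linarith)).add_posSemidef (hB.posSemidef.smul h0)

/-- **Split at a prescribed shift.**  A real symmetric `S` with `S + C•1 ≻ 0` is `YᵀY − C•1` with `det Y ≠ 0`.
[folklore] -/
theorem exists_gram_of_posDef_shift {S : Matrix ι ι ℝ} {C : ℝ}
    (h : (S + C • (1 : Matrix ι ι ℝ)).PosDef) :
    ∃ Y : Matrix ι ι ℝ, Y.det ≠ 0 ∧ S = Yᵀ * Y - C • (1 : Matrix ι ι ℝ) := by
  obtain ⟨Y, -, hY, hA, -⟩ := Census.exists_common_congruence (B := (0 : Matrix ι ι ℝ)) h isHermitian_zero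
  refine ⟨Y, hY, ?_⟩
  have hstar : star Y = Yᵀ := by
    rw [star_eq_conjTranspose, conjTranspose_eq_transpose_of_trivial]
  rw [← hstar, ← hA, add_sub_cancel_right]

/-- **Uniform split along a segment.**  For symmetric letter families `S`, `W` there is `C₀ > 0` such that for EVERY
`C ≥ C₀`, every `ε ∈ [0,1]` and every letter `l`, the segment letter `(1 − ε)•S l + ε•W l` splits as `YᵀY − C•1` with
`det Y ≠ 0`.  (One shift for the whole segment and all levels; `C` may still be moved off any finite bad set.)
[folklore] -/
theorem exists_uniform_split_segment {K : ℕ} (S W : Fin K → Matrix ι ι ℝ) (hS : ∀ l, (S l).IsSymm)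
    (hW : ∀ l, (W l).IsSymm) :
    ∃ C₀ : ℝ, 0 < C₀ ∧ ∀ C : ℝ, C₀ ≤ C → ∀ ε : ℝ, 0 ≤ ε → ε ≤ 1 → ∀ l : Fin K,
      ∃ Y : Matrix ι ι ℝ, Y.det ≠ 0 ∧ (1 - ε) • S l + ε • W l = Yᵀ * Y - C • (1 : Matrix ι ι ℝ) := by
  classical
  -- one shift for the 2K end letters
  obtain ⟨C₀, hC₀, hgood⟩ := exists_uniform_shift (Sum.elim S W) (fun k => by
    rcases k with l | l
    · exact hS l
    · exact hW l)
  refine ⟨C₀, hC₀, fun C hC ε h0 h1 l => ?_⟩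
  have hA : (S l + C • (1 : Matrix ι ι ℝ)).PosDef := posDef_add_smul_one_mono (hgood (Sum.inl l)) hC
  have hB : (W l + C • (1 : Matrix ι ι ℝ)).PosDef := posDef_add_smul_one_mono (hgood (Sum.inr l)) hC
  exact exists_gram_of_posDef_shift (posDef_segment_add_smul_one hA hB h0 h1)

end Summit.ValiantsHypothesis.ValiantsHypothesis.Theorems.LacunarySymmetroidMatrixDescartes.GPDensity
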